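import Summits.QuantumFields.BalabanUV.Beta.GAN24.CombBornLambdaUndressedRow
import Summits.QuantumFields.BalabanUV.Beta.GAN24.S3DiffLSymAt
import Summits.QuantumFields.BalabanUV.Beta.GAN24.S3DiffLtSymAt
import Summits.QuantumFields.BalabanUV.Beta.GAN24.BornLambdaDriftSup

/-!
# The (III′) Λ-born RATE half at an1's SYM table, part 1 of 2: the sup-currency SOCKET **`exists_hBdevLam_of_supLetters`** for M.50's `combBornOf Lc tabs cE 0 cΛ`
# (generic `d`) and the UNDRESSED top-aligned pair letter **`exists_pairU_sup_three`** — UNCONDITIONAL at `d = 3`, `2 ≤ Lc`, pin `cE = Lc^4`, `tabs.H = symHessFFAt (toSite rr) Lc`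
# («SYM-S3-Λ-DIFF»: `S3DiffLSymAt.diffL_three_at`, `S3DiffLtSymAt.diffLt_three_at` + M.76's exponent identities) — the comb ∕ sym twins of leaf-06 g41's (E)
# `BornLambdaDriftSup` §1–§2 and `BornLambdaUndressedDrift`

NOT IN PRINT — OUR BOOKKEEPING (road-P2 = `b2b-balaban-gan24-p2` gen 56, 2026-08-25; row G-an2-4 ∕ (CONV-C), the (α-0) chain at row D1's literal
OF RECORD (III′) `JsB12CombShSym`; [folklore] composition BY NAME — reindexing `(j, n) ↔ (k, i)`, the triangle inequality, `(m+1)^p s^m` bounded; 0 `def`, 0 cite,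
0 `def … : Prop`, 0 `sorry`).  Weight 0.  SOCKETS: the Λ CONTACT letter `hCg-Λ` and the Λ CONTACT PAIR letter `hPc-Λ` are OPEN at (III′) (the OWNER gan24-p1's
`PsiFace` ∕ conjugated-leg envelope words gate them); discharges NOTHING of (hS, hSall) by itself; NEVER «G-an2-4 closed» as (CONV-C); NOT D1, NOT BetaPertH,
NOT continuum, NOT Clay; NO campaign opened (an2 W-4) — typed while idle under R-2 (road-P2 MEMO M-gan24p2-g56-1, `gen56/S-CAMPAIGN-SIZING-g56.v0_7.md` §2(c)).

## Contents
§1 (generic `d`, a SOCKET; twin of `BornLambdaDriftSup.exists_hBdevLam_of_supLetters`) **`exists_hBdevLam_of_supLetters`**: the `k`-uniform row letter `hB` of the unit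
tables of `combBornOf Lc tabs cE 0 cΛ` + three SUP letters (fresh drift, top lineage, top-aligned pairs) ⇒ the all-scales Cauchy letter (leaf-06's schema
`BornLambdaDrift.exists_consec_of_pairLetters` at locality rate `0` over M.58's `unitS_combBornLam_eq_sum_push₃`, then road S3's `locStencilCauchy_of_uniform_supRate`).
§2 (`d = 3`, UNCONDITIONAL; twin of `BornLambdaUndressedDrift.exists_pairU_sup_three`) **`exists_pairU_sup_three`**: the UNDRESSED top-aligned pair letter, births `≥ 1`,
sup currency — `Lc^4 ×` the sym DIFF rows through M.76's `lineage_succ_pin_apply` ∕ `lineage_top_pin_apply`.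
§3 ([folklore]) `exists_contact_geometric_of_poly`: a poly-geometric letter `C·(k−i)^p·θ^{k−i}` is geometric `C·B·θ′^{k−i}` at `θ′ = (1+θ)∕2`
(`T4FlagMemoryPolyWeight.exists_bound_succ_pow_mul_pow`) — lets the one contact letter `hCg` (any log power) feed M.76's row socket `exists_hBLam_three_of_contact`.
-/

noncomputable section

open Finset
open scoped BigOperators
open Literature.MathematicalPhysics.QuantumFieldTheory
open Literature.MathematicalPhysics.QuantumFieldTheory.Balaban1983to89
open Literature.MathematicalPhysics.QuantumFieldTheory.Balaban1983to89.Beta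
open ExpKernelCalculus (MKer)
open OneStepResolventKernel (Fib LocStencil)
open AffineAveraging (box toSite)
open AveragingContoursRooted (ctr ctrOff)
open BalabanCompositeJets (respStep)
open StepJetData (locStencil_add)
open T4FlagMemoryPolyWeight (exists_bound_succ_pow_mul_pow pow_eq_ratio_pow_mul)
open Summit.QuantumFields.BalabanUV.Beta.HessKerDressedUnits (unitS)
open Summit.QuantumFields.BalabanUV.Beta.SymCorrectorKernel (psiKS)
open Summit.QuantumFields.BalabanUV.Beta.SymmetrisedStepJets (SymTables)
open Summit.QuantumFields.BalabanUV.Beta.SymAveragingHessianCounts (symHessFFAt)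
open Summit.QuantumFields.BalabanUV.Beta.GAN24.CombesThomas (sfStep smStep SupBound)
open Summit.QuantumFields.BalabanUV.Beta.GAN24.StencilSlotOfShapes (locStencil_mono')
open Summit.QuantumFields.BalabanUV.Beta.GAN24.StencilSlotSupRate (locStencilCauchy_of_uniform_supRate)
open Summit.QuantumFields.BalabanUV.Beta.GAN24.Push4 (legComp IsFF)
open Summit.QuantumFields.BalabanUV.Beta.GAN24.Push4Iter (legChain)
open Summit.QuantumFields.BalabanUV.Beta.GAN24.Push3 (push₃)
open Summit.QuantumFields.BalabanUV.Beta.GAN24.RespStepBmDecompExact (respStepBmSeq)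
open Summit.QuantumFields.BalabanUV.Beta.GAN24.BornLambdaDrift (exists_consec_of_pairLetters)
open Summit.QuantumFields.BalabanUV.Beta.GAN24.BornLambdaDriftSup (locStencil_zero_iff_supBound locStencil_zero_of_locStencil)
open Summit.QuantumFields.BalabanUV.Beta.GAN24.CombWilsonSector (combBornOf)
open Summit.QuantumFields.BalabanUV.Beta.GAN24.CombBornSector (combFreshAt)
open Summit.QuantumFields.BalabanUV.Beta.GAN24.CombBornLambdaLineage (unitS_combBornLam_eq_sum_push₃)
open Summit.QuantumFields.BalabanUV.Beta.GAN24.CombBornLambdaUndressedRow (lineage_succ_pin_apply lineage_top_pin_apply)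
open Summit.QuantumFields.BalabanUV.Beta.GAN24.S3DiffLSymAt (diffL_three_at)
open Summit.QuantumFields.BalabanUV.Beta.GAN24.S3DiffLtSymAt (diffLt_three_at)

namespace Summit.QuantumFields.BalabanUV.Beta.GAN24.CombBornLambdaDriftSup

/-! ## §1 The rate half from a uniform row letter and three sup letters (generic `d`; a SOCKET) -/

section Letters

variable {d : ℕ} {Lc : ℕ} [NeZero Lc] (tabs : SymTables d Lc)

/-- NOT IN PRINT; OUR BOOKKEEPING (generic `d`, centred comb roots; a SOCKET; the comb twin of leaf-06 g41's `BornLambdaDriftSup.exists_hBdevLam_of_supLetters`).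
**THE RATE HALF OF THE (III′) Λ-BORN ROW FROM A UNIFORM LETTER AND THREE SUP-NORM LETTERS**: the `k`-uniform local-stencil letter `hB` of the unit tables `U_k` of
`combBornOf Lc tabs cE 0 cΛ` (one `CB, δB > 0` for all levels), a fresh-source SUP drift `CF·θF^k`, a top-lineage SUP letter `CT·(k+1)^p·θT^{k+1}` and top-aligned
pair SUP letters `CP·(k−i)^q·Θ^k` (entrywise, NO decay asked; the dressed chains are the comb chains `legChain (legComp Ψ ∘ respStepBmSeq (ctr) Lc) i (k−1−i)`)
give the all-scales Cauchy letter `LocStencil (U_{k+j} − U_k) (cB·θB^k) (δB∕2)` — leaf-06's schema `exists_consec_of_pairLetters` at locality rate `0` over M.58's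
`unitS_combBornLam_eq_sum_push₃`, then road S3's interpolation `locStencilCauchy_of_uniform_supRate` (`θB = √θ`). -/
theorem exists_hBdevLam_of_supLetters (hHff : ∀ μ y, IsFF (tabs.H μ y)) (cE cΛ : ℝ) {p q : ℕ}
    (hB : ∃ CB δB : ℝ, 0 < δB ∧ ∀ k : ℕ, LocStencil (unitS (sfStep Lc k) (smStep d Lc k) (combBornOf Lc tabs cE 0 cΛ k)) CB δB)
    (hXd : ∃ CF θF : ℝ, 0 ≤ CF ∧ 0 ≤ θF ∧ θF < 1 ∧ ∀ (k : ℕ) κ u,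
      SupBound ((unitS (sfStep Lc (k + 1)) (smStep d Lc (k + 1)) (combFreshAt tabs 0 cΛ (k + 1))
        - unitS (sfStep Lc k) (smStep d Lc k) (combFreshAt tabs 0 cΛ k)) κ u) (CF * θF ^ k))
    (hT : ∃ CT θT : ℝ, 0 ≤ CT ∧ 0 ≤ θT ∧ θT < 1 ∧ ∀ (k : ℕ) κ u,
      SupBound ((fun κ' u' => (cE * (Lc : ℝ) ^ (2 * (d + 1))) ^ (k + 1) •
        push₃ (legChain (fun j => legComp (fun α x κ u => psiKS (ctrOff (d + 1) Lc) Lc u x (Sum.inl κ) (Sum.inl α)) (respStepBmSeq (d := d) (ctr (d + 1) Lc) Lc j)) 0 k) (legChain (fun j => legComp (fun α x κ u => psiKS (ctrOff (d + 1) Lc) Lc u x (Sum.inl κ) (Sum.inl α)) (respStepBmSeq (d := d) (ctr (d + 1) Lc) Lc j)) 0 k)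
              (legChain (fun j => legComp (fun α x κ u => psiKS (ctrOff (d + 1) Lc) Lc u x (Sum.inl κ) (Sum.inl α)) (respStepBmSeq (d := d) (ctr (d + 1) Lc) Lc j)) 0 k)
              (unitS (sfStep Lc 0) (smStep d Lc 0) (combFreshAt tabs 0 cΛ 0)) κ' u') κ u) (CT * ((((k + 1 : ℕ) : ℝ)) ^ p * θT ^ (k + 1))))
    (hP : ∃ CP Θ : ℝ, 0 ≤ CP ∧ 0 ≤ Θ ∧ Θ < 1 ∧ ∀ k i : ℕ, i < k → ∀ κ u,
      SupBound
        (((fun κ' u' => (cE * (Lc : ℝ) ^ (2 * (d + 1))) ^ (k - i) •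
            push₃ (legChain (fun j => legComp (fun α x κ u => psiKS (ctrOff (d + 1) Lc) Lc u x (Sum.inl κ) (Sum.inl α)) (respStepBmSeq (d := d) (ctr (d + 1) Lc) Lc j)) (i + 1) (k - 1 - i)) (legChain (fun j => legComp (fun α x κ u => psiKS (ctrOff (d + 1) Lc) Lc u x (Sum.inl κ) (Sum.inl α)) (respStepBmSeq (d := d) (ctr (d + 1) Lc) Lc j)) (i + 1) (k - 1 - i))
              (legChain (fun j => legComp (fun α x κ u => psiKS (ctrOff (d + 1) Lc) Lc u x (Sum.inl κ) (Sum.inl α)) (respStepBmSeq (d := d) (ctr (d + 1) Lc) Lc j)) (i + 1) (k - 1 - i))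
              (unitS (sfStep Lc (i + 1)) (smStep d Lc (i + 1)) (combFreshAt tabs 0 cΛ (i + 1))) κ' u')
          - fun κ' u' => (cE * (Lc : ℝ) ^ (2 * (d + 1))) ^ (k - i) •
            push₃ (legChain (fun j => legComp (fun α x κ u => psiKS (ctrOff (d + 1) Lc) Lc u x (Sum.inl κ) (Sum.inl α)) (respStepBmSeq (d := d) (ctr (d + 1) Lc) Lc j)) i (k - 1 - i)) (legChain (fun j => legComp (fun α x κ u => psiKS (ctrOff (d + 1) Lc) Lc u x (Sum.inl κ) (Sum.inl α)) (respStepBmSeq (d := d) (ctr (d + 1) Lc) Lc j)) i (k - 1 - i))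
              (legChain (fun j => legComp (fun α x κ u => psiKS (ctrOff (d + 1) Lc) Lc u x (Sum.inl κ) (Sum.inl α)) (respStepBmSeq (d := d) (ctr (d + 1) Lc) Lc j)) i (k - 1 - i))
              (unitS (sfStep Lc i) (smStep d Lc i) (combFreshAt tabs 0 cΛ i)) κ' u') κ u)
        (CP * ((((k - i : ℕ) : ℝ)) ^ q * Θ ^ k))) :
    ∃ cB θB δB : ℝ, 0 ≤ cB ∧ 0 ≤ θB ∧ θB < 1 ∧ 0 < δB ∧ ∀ k j : ℕ,
      LocStencil (unitS (sfStep Lc (k + j)) (smStep d Lc (k + j)) (combBornOf Lc tabs cE 0 cΛ (k + j))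
        - unitS (sfStep Lc k) (smStep d Lc k) (combBornOf Lc tabs cE 0 cΛ k)) (cB * θB ^ k) δB := by
  obtain ⟨CB, δB, hδB, hB⟩ := hB
  obtain ⟨CF, θF, hCF, hθF0, hθF1, hXd⟩ := hXd
  obtain ⟨CT, θT, hCT, hθT0, hθT1, hT⟩ := hT
  obtain ⟨CP, Θ, hCP, hΘ0, hΘ1, hP⟩ := hP
  -- leaf-06's schema at locality rate 0 = the one-step SUP rate of `U`
  obtain ⟨c, θ, hc, hθ0, hθ1, hschema⟩ :=
    exists_consec_of_pairLetters (d := d) (δ := 0) (p := p) (q := q) hCF hθF0 hθF1 hCT hθT0 hθT1 hCP hΘ0 hΘ1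
  have hCB : 0 ≤ CB := ((hB 0) 0 0).nonneg (Sum.inl 0)
  have h1θ : 0 < 1 - θ := by linarith
  refine ⟨Real.sqrt (2 * (c / (1 - θ)) * CB), Real.sqrt θ, δB / 2, Real.sqrt_nonneg _, Real.sqrt_nonneg _,
    (Real.sqrt_lt' one_pos).2 (by rwa [one_pow]), by positivity, fun k j => ?_⟩
  -- the one-step sup rate
  have hrate : ∀ (n : ℕ) κ u, SupBound (unitS (sfStep Lc (n + 1)) (smStep d Lc (n + 1)) (combBornOf Lc tabs cE 0 cΛ (n + 1)) κ u
      - unitS (sfStep Lc n) (smStep d Lc n) (combBornOf Lc tabs cE 0 cΛ n) κ u) (c * θ ^ n) := by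
    intro n
    have h0 : LocStencil (unitS (sfStep Lc (n + 1)) (smStep d Lc (n + 1)) (combBornOf Lc tabs cE 0 cΛ (n + 1))
        - unitS (sfStep Lc n) (smStep d Lc n) (combBornOf Lc tabs cE 0 cΛ n)) (c * θ ^ n) 0 := by
      rw [unitS_combBornLam_eq_sum_push₃ tabs hHff cE cΛ (n + 1), unitS_combBornLam_eq_sum_push₃ tabs hHff cE cΛ n]
      refine hschema (fun k => unitS (sfStep Lc k) (smStep d Lc k) (combFreshAt tabs 0 cΛ k))
        (fun i k => fun κ' u' => (cE * (Lc : ℝ) ^ (2 * (d + 1))) ^ (k - i) •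
          push₃ (legChain (fun j => legComp (fun α x κ u => psiKS (ctrOff (d + 1) Lc) Lc u x (Sum.inl κ) (Sum.inl α)) (respStepBmSeq (d := d) (ctr (d + 1) Lc) Lc j)) i (k - 1 - i)) (legChain (fun j => legComp (fun α x κ u => psiKS (ctrOff (d + 1) Lc) Lc u x (Sum.inl κ) (Sum.inl α)) (respStepBmSeq (d := d) (ctr (d + 1) Lc) Lc j)) i (k - 1 - i))
              (legChain (fun j => legComp (fun α x κ u => psiKS (ctrOff (d + 1) Lc) Lc u x (Sum.inl κ) (Sum.inl α)) (respStepBmSeq (d := d) (ctr (d + 1) Lc) Lc j)) i (k - 1 - i))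
              (unitS (sfStep Lc i) (smStep d Lc i) (combFreshAt tabs 0 cΛ i)) κ' u')
        (fun k => locStencil_zero_iff_supBound.2 (hXd k)) (fun k => ?_) (fun k i hik => ?_) n
      · have h := locStencil_zero_iff_supBound.2 (hT k)
        simp only [Nat.sub_zero, Nat.add_sub_cancel]
        exact h
      · have h := locStencil_zero_iff_supBound.2 (hP k i hik)
        have e2 : k - (i + 1) = k - 1 - i := by omega
        simp only [Nat.add_sub_add_right, Nat.add_sub_cancel, e2]
        exact h
    intro κ u
    exact (locStencil_zero_iff_supBound.1 h0) κ u
  exact locStencilCauchy_of_uniform_supRate (F := fun n => unitS (sfStep Lc n) (smStep d Lc n) (combBornOf Lc tabs cE 0 cΛ n))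
    (fun n => hB n) hrate hc hθ0.le hθ1 k j

end Letters

/-! ## §2 `d = 3`: the UNDRESSED top-aligned pair letter at the sym table, births `≥ 1`, sup currency — UNCONDITIONAL -/

section Undressed

variable {Lc : ℕ} [NeZero Lc] (tabs : SymTables 3 Lc) (hHff : ∀ μ y, IsFF (tabs.H μ y))
include hHff

/-- NOT IN PRINT; OUR BOOKKEEPING (`d = 3`, `2 ≤ Lc`, pin `cE = Lc^4`, `tabs.H = symHessFFAt (toSite rr) Lc`, UNCONDITIONAL; the comb ∕ sym twin of leaf-06 g41's
`BornLambdaUndressedDrift.exists_pairU_sup_three`).  **THE UNDRESSED TOP-ALIGNED PAIR LETTER, BIRTHS `≥ 1`, SUP CURRENCY**: ONE `CU ≥ 0` and ONE `0 < Θ < 1` with, for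
every birth `j+1 ≥ 1`, every length `n+1 ≥ 1` and every entry, `|(cE·Lc^8)^{n+1}·push₃ B³_{j+2→j+n+3} X_{j+2} − (cE·Lc^8)^{n+1}·push₃ B³_{j+1→j+n+2} X_{j+1}| ≤ CU·Θ^{j+n+1}`
(`X_i = unitS_i (combFreshAt tabs 0 cΛ i)`) — `Lc^4 ×` the SYM DIFF rows `S3DiffLtSymAt.diffLt_three_at` (`n = 0`) and `S3DiffLSymAt.diffL_three_at` (`n ≥ 1`, the extra
`ρ^{n−1} ≤ 1` dropped) through M.76's exponent identities; `Θ = max (max θL θLt) ½`. -/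
theorem exists_pairU_sup_three (hLc : 2 ≤ Lc) {rr : Fin (3 + 1) → ℕ} (hrr : rr ∈ box (3 + 1) Lc) (hH : tabs.H = symHessFFAt (toSite rr) Lc)
    {cE : ℝ} (hcE : cE = (Lc : ℝ) ^ (3 + 1)) (cΛ : ℝ) :
    ∃ CU Θ : ℝ, 0 ≤ CU ∧ 0 < Θ ∧ Θ < 1 ∧ ∀ (j n : ℕ) (κ' : Fin (3 + 1)) (u' : Fin (3 + 1) → ℤ),
      SupBound (fun x' z' a b =>
        ((cE * (Lc : ℝ) ^ (2 * (3 + 1))) ^ (n + 1) •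
            push₃ (respStep (d := 3) (Lc ^ (j + 1 + 1)) (Lc ^ (j + 1 + n + 1 + 1))) (respStep (d := 3) (Lc ^ (j + 1 + 1)) (Lc ^ (j + 1 + n + 1 + 1)))
              (respStep (d := 3) (Lc ^ (j + 1 + 1)) (Lc ^ (j + 1 + n + 1 + 1)))
              (unitS (sfStep Lc (j + 1 + 1)) (smStep 3 Lc (j + 1 + 1)) (combFreshAt tabs 0 cΛ (j + 1 + 1))) κ' u') x' z' a b -
          ((cE * (Lc : ℝ) ^ (2 * (3 + 1))) ^ (n + 1) •
            push₃ (respStep (d := 3) (Lc ^ (j + 1)) (Lc ^ (j + n + 1 + 1))) (respStep (d := 3) (Lc ^ (j + 1)) (Lc ^ (j + n + 1 + 1)))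
              (respStep (d := 3) (Lc ^ (j + 1)) (Lc ^ (j + n + 1 + 1)))
              (unitS (sfStep Lc (j + 1)) (smStep 3 Lc (j + 1)) (combFreshAt tabs 0 cΛ (j + 1))) κ' u') x' z' a b)
        (CU * Θ ^ (j + n + 1)) := by
  have hL0 : (0 : ℝ) < Lc := by exact_mod_cast Nat.pos_of_ne_zero (NeZero.ne Lc)
  obtain ⟨eL, θL, ρ, hθL0, hθL1, hρ0, hρ1, hdL⟩ := diffL_three_at (Lc := Lc) hLc cΛ
  obtain ⟨cLt, θT, hcLt, hθT0, hθT1, hdLt⟩ := diffLt_three_at (Lc := Lc) hLc cΛ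
  -- the common rate, bounded away from `0`
  set Θ : ℝ := max (max θL θT) (1 / 2) with hΘ
  have hΘ0 : 0 < Θ := lt_of_lt_of_le (by norm_num) (le_max_right _ _)
  have hΘ1 : Θ < 1 := max_lt (max_lt hθL1 hθT1) (by norm_num)
  have hθLΘ : θL ≤ Θ := (le_max_left _ _).trans (le_max_left _ _)
  have hθTΘ : θT ≤ Θ := (le_max_right _ _).trans (le_max_left _ _)
  -- `eL` may be negative a priori: take `|eL|`
  refine ⟨(Lc : ℝ) ^ (3 + 1) * (|eL| + cLt) / Θ, Θ, by positivity, hΘ0, hΘ1, fun j n κ' u' x' z' a b => ?_⟩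
  dsimp only
  rcases Nat.eq_zero_or_pos n with hn | hn
  · -- the top pair: `Lc^4 ×` row dLt at `n″ = j`
    subst hn
    have e1 := lineage_top_pin_apply tabs hHff hH hcE cΛ (j + 1) κ' u' x' z' a b
    have e0 := lineage_top_pin_apply tabs hHff hH hcE cΛ j κ' u' x' z' a b
    simp only [Nat.add_zero, Nat.zero_add, pow_one] at e1 e0 ⊢
    rw [e1, e0, ← mul_sub, abs_mul, abs_of_pos (pow_pos hL0 _)]
    have h := hdLt rr hrr j κ' u' x' z' a b
    dsimp only at h
    refine (mul_le_mul_of_nonneg_left h (pow_nonneg hL0.le _)).trans ?_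
    have hp : θT ^ (j + 1) ≤ Θ ^ (j + 1) := pow_le_pow_left₀ hθT0 hθTΘ _
    have hΘj : 0 ≤ Θ ^ (j + 1) := pow_nonneg hΘ0.le _
    have hL4 : 0 ≤ (Lc : ℝ) ^ (3 + 1) := pow_nonneg hL0.le _
    have hkey : (Lc : ℝ) ^ (3 + 1) * (cLt * Θ ^ (j + 1)) ≤ (Lc : ℝ) ^ (3 + 1) * (|eL| + cLt) / Θ * Θ ^ (j + 1) := by
      rw [div_mul_eq_mul_div, le_div_iff₀ hΘ0]
      calc (Lc : ℝ) ^ (3 + 1) * (cLt * Θ ^ (j + 1)) * Θ ≤ (Lc : ℝ) ^ (3 + 1) * (cLt * Θ ^ (j + 1)) * 1 :=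
            mul_le_mul_of_nonneg_left hΘ1.le (mul_nonneg hL4 (mul_nonneg hcLt hΘj))
        _ ≤ (Lc : ℝ) ^ (3 + 1) * (|eL| + cLt) * Θ ^ (j + 1) := by
            rw [mul_one]
            have : cLt ≤ |eL| + cLt := by linarith [abs_nonneg eL]
            nlinarith [mul_nonneg hL4 hΘj, mul_le_mul_of_nonneg_left this (mul_nonneg hL4 hΘj)]
    calc (Lc : ℝ) ^ (3 + 1) * (cLt * θT ^ (j + 1)) ≤ (Lc : ℝ) ^ (3 + 1) * (cLt * Θ ^ (j + 1)) := by gcongr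
      _ ≤ (Lc : ℝ) ^ (3 + 1) * (|eL| + cLt) / Θ * Θ ^ (j + 1) := hkey
  · -- a pair of length `n+1 ≥ 2`: `Lc^4 ×` row dL at `(n″, m) = (j+n, j)`
    obtain ⟨n', rfl⟩ : ∃ n', n = n' + 1 := ⟨n - 1, by omega⟩
    have e1 := lineage_succ_pin_apply tabs hHff hH hcE cΛ (j + 1) (n' + 1) κ' u' x' z' a b
    have e0 := lineage_succ_pin_apply tabs hHff hH hcE cΛ j (n' + 1) κ' u' x' z' a b
    simp only [Nat.add_sub_cancel_left] at e1 e0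
    rw [e1, e0, ← mul_sub, abs_mul, abs_of_pos (pow_pos hL0 _)]
    have h := hdL rr hrr (j + (n' + 1)) j (by omega) κ' u' x' z' a b
    dsimp only at h
    rw [show j + (n' + 1) - j = n' + 1 by omega, show j + (n' + 1) + 1 + 1 + 1 = j + 1 + (n' + 1) + 1 + 1 by omega] at h
    refine (mul_le_mul_of_nonneg_left h (pow_nonneg hL0.le _)).trans ?_
    have hL4 : 0 ≤ (Lc : ℝ) ^ (3 + 1) := pow_nonneg hL0.le _
    have hp : θL ^ (j + (n' + 1) + 1) ≤ Θ ^ (j + (n' + 1) + 1) := pow_le_pow_left₀ hθL0 hθLΘ _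
    have hρ : ρ ^ (n' + 1) ≤ 1 := pow_le_one₀ hρ0 hρ1.le
    have hΘj : 0 ≤ Θ ^ (j + (n' + 1) + 1) := pow_nonneg hΘ0.le _
    have hkey : (Lc : ℝ) ^ (3 + 1) * (|eL| * Θ ^ (j + (n' + 1) + 1)) ≤
        (Lc : ℝ) ^ (3 + 1) * (|eL| + cLt) / Θ * Θ ^ (j + (n' + 1) + 1) := by
      rw [div_mul_eq_mul_div, le_div_iff₀ hΘ0]
      calc (Lc : ℝ) ^ (3 + 1) * (|eL| * Θ ^ (j + (n' + 1) + 1)) * Θ ≤ (Lc : ℝ) ^ (3 + 1) * (|eL| * Θ ^ (j + (n' + 1) + 1)) * 1 :=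
            mul_le_mul_of_nonneg_left hΘ1.le (mul_nonneg hL4 (mul_nonneg (abs_nonneg _) hΘj))
        _ ≤ (Lc : ℝ) ^ (3 + 1) * (|eL| + cLt) * Θ ^ (j + (n' + 1) + 1) := by
            rw [mul_one]
            have : |eL| ≤ |eL| + cLt := by linarith
            nlinarith [mul_nonneg hL4 hΘj, mul_le_mul_of_nonneg_left this (mul_nonneg hL4 hΘj)]
    calc (Lc : ℝ) ^ (3 + 1) * (eL * θL ^ (j + (n' + 1) + 1) * ρ ^ (n' + 1))
        ≤ (Lc : ℝ) ^ (3 + 1) * (|eL| * Θ ^ (j + (n' + 1) + 1) * 1) := by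
          refine mul_le_mul_of_nonneg_left ?_ hL4
          calc eL * θL ^ (j + (n' + 1) + 1) * ρ ^ (n' + 1) ≤ |eL| * θL ^ (j + (n' + 1) + 1) * ρ ^ (n' + 1) := by
                gcongr; exact le_abs_self eL
            _ ≤ |eL| * Θ ^ (j + (n' + 1) + 1) * 1 := by gcongr
      _ = (Lc : ℝ) ^ (3 + 1) * (|eL| * Θ ^ (j + (n' + 1) + 1)) := by rw [mul_one]
      _ ≤ (Lc : ℝ) ^ (3 + 1) * (|eL| + cLt) / Θ * Θ ^ (j + (n' + 1) + 1) := hkey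

end Undressed

/-! ## §3 A poly-geometric letter is geometric at a slower rate ([folklore]) -/

section PolyGeom

/-- [folklore] **A POLY-GEOMETRIC LETTER IS GEOMETRIC AT THE SLOWER RATE `θ′ = (1+θ)∕2`**: `(k−i)^p·θ^{k−i} ≤ B·θ′^{k−i}` with ONE `B ≥ 1`
(`T4FlagMemoryPolyWeight.exists_bound_succ_pow_mul_pow` at `s = θ∕θ′ < 1`, `pow_eq_ratio_pow_mul`), for any family of local stencil letters indexed by `i < k`. -/
theorem exists_contact_geometric_of_poly {S : ℕ → ℕ → Fin (3 + 1) → (Fin (3 + 1) → ℤ) → MKer (3 + 1) (Fib 3)} {p : ℕ}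
    (h : ∃ C θ δ : ℝ, 0 ≤ C ∧ 0 ≤ θ ∧ θ < 1 ∧ 0 < δ ∧ ∀ k i : ℕ, i < k →
      LocStencil (S k i) (C * ((((k - i : ℕ) : ℝ)) ^ p * θ ^ (k - i))) δ) :
    ∃ C θ δ : ℝ, 0 ≤ C ∧ 0 ≤ θ ∧ θ < 1 ∧ 0 < δ ∧ ∀ k i : ℕ, i < k → LocStencil (S k i) (C * θ ^ (k - i)) δ := by
  obtain ⟨C, θ, δ, hC, hθ0, hθ1, hδ, h⟩ := h
  set θ' : ℝ := (1 + θ) / 2 with hθ'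
  have hθ'0 : 0 < θ' := by rw [hθ']; linarith
  have hθ'1 : θ' < 1 := by rw [hθ']; linarith
  have hθθ' : θ < θ' := by rw [hθ']; linarith
  have hs0 : 0 ≤ θ / θ' := div_nonneg hθ0 hθ'0.le
  have hs1 : θ / θ' < 1 := (div_lt_one hθ'0).2 hθθ'
  obtain ⟨B, hB1, hB⟩ := exists_bound_succ_pow_mul_pow hs0 hs1 p
  refine ⟨C * B, θ', δ, mul_nonneg hC (zero_le_one.trans hB1), hθ'0.le, hθ'1, hδ, fun k i hik => ?_⟩
  refine locStencil_mono' (h k i hik) ?_ le_rfl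
  have hm : ((((k - i : ℕ) : ℝ)) ^ p * θ ^ (k - i)) ≤ B * θ' ^ (k - i) := by
    rw [pow_eq_ratio_pow_mul hθ'0.ne' (k - i)]
    have h1 : (((k - i : ℕ) : ℝ)) ^ p ≤ ((((k - i : ℕ) : ℝ)) + 1) ^ p :=
      pow_le_pow_left₀ (Nat.cast_nonneg _) (by linarith) p
    calc (((k - i : ℕ) : ℝ)) ^ p * ((θ / θ') ^ (k - i) * θ' ^ (k - i))
        = ((((k - i : ℕ) : ℝ)) ^ p * (θ / θ') ^ (k - i)) * θ' ^ (k - i) := by ring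
      _ ≤ (((((k - i : ℕ) : ℝ)) + 1) ^ p * (θ / θ') ^ (k - i)) * θ' ^ (k - i) :=
          mul_le_mul_of_nonneg_right (mul_le_mul_of_nonneg_right h1 (pow_nonneg hs0 _)) (pow_nonneg hθ'0.le _)
      _ ≤ B * θ' ^ (k - i) := mul_le_mul_of_nonneg_right (hB (k - i)) (pow_nonneg hθ'0.le _)
  calc C * ((((k - i : ℕ) : ℝ)) ^ p * θ ^ (k - i)) ≤ C * (B * θ' ^ (k - i)) := mul_le_mul_of_nonneg_left hm hC
    _ = C * B * θ' ^ (k - i) := (mul_assoc _ _ _).symm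

end PolyGeom

end Summit.QuantumFields.BalabanUV.Beta.GAN24.CombBornLambdaDriftSup

end
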